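import Literature.GroupTheory.CombinatorialGroupTheory.PuncturedSurfaceGroupNodeLoopBasis
import Literature.GroupTheory.CombinatorialGroupTheory.PuncturedSurfaceGroupCusps
import Mathlib.GroupTheory.Coprod.Basic
import Mathlib.GroupTheory.QuotientGroup.Basic
import HarnessLib

/-!
# The unramified quotient of the two-component affine degeneration: `Γ_{g₀+g₁,r}/⟨⟨c_j, ε⟩⟩ ≅ Γ_{g₀,0} ∗ Γ_{g₁,0}`

Topic `Literature/GroupTheory/CombinatorialGroupTheory`; theorems only (a Tietze computation).  [CombGC]
Def. 1.1 (ii) p. 7 (the unramified quotient `Π^unr_G`) [cite: MochizukiCombGC2007, Def 1.1(ii) p.7] at the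
two-component affine data of abc-iut-f-164 (`PSCTwoComponentAffineShape.lean`: `Γ_{g,r}`, handles `i < g₀`
on `C₀`, node loop `ε = (c_s⋯c_{r−1})·∏_{i<g₀}[a_i,b_i]`): killing every cusp generator `c_j` and the node
loop `ε` kills `∏_{i<g₀}[a_i,b_i]` and then, by the relator, `∏_{i≥g₀}[a_i,b_i]`; what is left is the free
product of the two CLOSED surface groups.

* `exists_mulEquiv_unrQuotient_coprod` — for `g = g₀ + g₁` an isomorphism
  `Γ_{g,r} ⧸ ⟨⟨{ε} ∪ {c_j}⟩⟩ ≃* Γ_{g₀,0} ∗ Γ_{g₁,0}` (`Monoid.Coprod`) with `[a_i] ↦ inl a_i`, `[b_i] ↦ inl b_i`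
  (`i = castAdd i₀`), `[a_i] ↦ inr a_j`, `[b_i] ↦ inr b_j` (`i = natAdd j`).

Door D1 step (i) of abc-iut-f-166's sturdy `Π^unr`-separating-covering programme (engine
`FreeProductFibredTwist`, discrete separation `FreeProductSurfaceSeparation`, completion transfer
`PSCUnrKerOfEdgeGenerators`).  Elementary; nothing here concerns [IUTchIII].
-/

namespace Literature.GroupTheory.CombinatorialGroupTheory

namespace PuncturedSurfaceGroup

open Monoid (Coprod)

/-- Generators as `PresentedGroup.of`: `a_i = of (inl (i,false))`, `b_i = of (inl (i,true))`.
[cite: MochizukiSemiAnbd2006, Ex. 2.10 p.31] -/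
theorem of_inl_eq {g r : ℕ} (i : Fin g) (bit : Bool) :
    (PresentedGroup.of (Sum.inl (i, bit)) : PuncturedSurfaceGroup g r) = if bit then b i else a i := by
  cases bit <;> rfl

/-- The relator of the CLOSED surface group: `∏_i [a_i,b_i] = 1` in `Γ_{g,0}`.
[cite: MochizukiSemiAnbd2006, Ex. 2.10 p.31] -/
theorem comm_prod_eq_one_zero (g : ℕ) :
    ((List.finRange g).map fun i : Fin g =>
      a (r := 0) i * b i * (a i)⁻¹ * (b i)⁻¹).prod = 1 := by
  have h := comm_prod_mul_cusp_prod_eq_one (g := g) (r := 0)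
  rw [List.finRange_zero, List.map_nil, List.prod_nil, mul_one] at h
  exact h

/-- Splitting a padded `finRange (g₀+g₁)` product along `Fin.castAdd` / `Fin.natAdd`.
[cite: MochizukiSemiAnbd2006, Ex. 2.10 p.31] -/
theorem prod_map_finRange_add {M : Type*} [Monoid M] (g₀ g₁ : ℕ) (F : Fin (g₀ + g₁) → M) :
    ((List.finRange (g₀ + g₁)).map F).prod =
      ((List.finRange g₀).map fun i => F (Fin.castAdd g₁ i)).prod *
        ((List.finRange g₁).map fun j => F (Fin.natAdd g₀ j)).prod := by
  rw [← List.ofFn_eq_map, ← List.ofFn_eq_map, ← List.ofFn_eq_map, List.ofFn_add, List.prod_append]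
  rfl

/-- **`Γ_{g₀+g₁,r} ⧸ ⟨⟨ε, c_0, …, c_{r−1}⟩⟩ ≅ Γ_{g₀,0} ∗ Γ_{g₁,0}`** for the node loop
`ε = (c_s⋯c_{r−1})·∏_{i<g₀}[a_i,b_i]` of the two-component affine degeneration, with the evident values on
the handle generators. [cite: MochizukiCombGC2007, Def 1.1(ii) p.7] -/
theorem exists_mulEquiv_unrQuotient_coprod (g₀ g₁ r s : ℕ) (ε : PuncturedSurfaceGroup (g₀ + g₁) r)
    (hε : ε = ((List.finRange r).map fun j : Fin r => if s ≤ (j : ℕ) then c (g := g₀ + g₁) j else 1).prod *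
      ((List.finRange (g₀ + g₁)).map fun i : Fin (g₀ + g₁) => if (i : ℕ) < g₀ then
        a (r := r) i * b i * (a i)⁻¹ * (b i)⁻¹ else 1).prod) :
    ∃ (_hK : (Subgroup.normalClosure ({ε} ∪ Set.range (c : Fin r → PuncturedSurfaceGroup (g₀ + g₁) r))).Normal)
      (e : PuncturedSurfaceGroup (g₀ + g₁) r ⧸
          Subgroup.normalClosure ({ε} ∪ Set.range (c : Fin r → PuncturedSurfaceGroup (g₀ + g₁) r)) ≃*
        Coprod (PuncturedSurfaceGroup g₀ 0) (PuncturedSurfaceGroup g₁ 0)),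
      (∀ (i : Fin g₀) (bit : Bool),
        e (QuotientGroup.mk (PresentedGroup.of (Sum.inl (Fin.castAdd g₁ i, bit)))) =
          Coprod.inl (PresentedGroup.of (Sum.inl (i, bit)))) ∧
      ∀ (j : Fin g₁) (bit : Bool),
        e (QuotientGroup.mk (PresentedGroup.of (Sum.inl (Fin.natAdd g₀ j, bit)))) =
          Coprod.inr (PresentedGroup.of (Sum.inl (j, bit))) := by
  classical
  set K : Subgroup (PuncturedSurfaceGroup (g₀ + g₁) r) :=
    Subgroup.normalClosure ({ε} ∪ Set.range (c : Fin r → PuncturedSurfaceGroup (g₀ + g₁) r)) with hKdef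
  haveI hKn : K.Normal := Subgroup.normalClosure_normal
  have hcK : ∀ j, c (g := g₀ + g₁) (r := r) j ∈ K := fun j =>
    Subgroup.subset_normalClosure (Or.inr ⟨j, rfl⟩)
  have hεK : ε ∈ K := Subgroup.subset_normalClosure (Or.inl rfl)
  -- the pieces of the relator
  set X : PuncturedSurfaceGroup (g₀ + g₁) r := ((List.finRange (g₀ + g₁)).map fun i : Fin (g₀ + g₁) => if (i : ℕ) < g₀ then
        a (r := r) i * b i * (a i)⁻¹ * (b i)⁻¹ else 1).prod with hX
  set Y : PuncturedSurfaceGroup (g₀ + g₁) r := ((List.finRange (g₀ + g₁)).map fun i : Fin (g₀ + g₁) => if g₀ ≤ (i : ℕ) then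
        a (r := r) i * b i * (a i)⁻¹ * (b i)⁻¹ else 1).prod with hY
  set C' : PuncturedSurfaceGroup (g₀ + g₁) r := ((List.finRange r).map fun j : Fin r => if (j : ℕ) < s then c (g := g₀ + g₁) j else 1).prod
    with hC'
  set C'' : PuncturedSurfaceGroup (g₀ + g₁) r := ((List.finRange r).map fun j : Fin r => if s ≤ (j : ℕ) then c (g := g₀ + g₁) j else 1).prod
    with hC''
  have hrel : X * Y * (C' * C'') = 1 := comm_split_mul_cusp_split_eq_one (g := g₀ + g₁) (r := r) g₀ s
  have hC'K : C' ∈ K := prod_map_finRange_ite_mem K r _ _ fun j _ => hcK j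
  have hC''K : C'' ∈ K := prod_map_finRange_ite_mem K r _ _ fun j _ => hcK j
  have hXK : X ∈ K := by
    have hXe : X = C''⁻¹ * ε := by rw [hε, inv_mul_cancel_left]
    rw [hXe]; exact K.mul_mem (K.inv_mem hC''K) hεK
  have hYK : Y ∈ K := by
    have hYe : Y = X⁻¹ * (C' * C'')⁻¹ := by
      have h1 : Y * (C' * C'') = X⁻¹ := eq_inv_of_mul_eq_one_right (by rw [← mul_assoc]; exact hrel)
      rw [← h1, mul_inv_cancel_right]
    rw [hYe]; exact K.mul_mem (K.inv_mem hXK) (K.inv_mem (K.mul_mem hC'K hC''K))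
  -- `X`, `Y` as products over the two halves
  have hX' : X = ((List.finRange g₀).map fun i : Fin g₀ =>
      a (r := r) (Fin.castAdd g₁ i) * b (Fin.castAdd g₁ i) * (a (Fin.castAdd g₁ i))⁻¹ *
        (b (Fin.castAdd g₁ i))⁻¹).prod := by
    rw [hX, prod_map_finRange_add]
    have h2 : ((List.finRange g₁).map fun j : Fin g₁ =>
        (fun i : Fin (g₀ + g₁) => if (i : ℕ) < g₀ then a (r := r) i * b i * (a i)⁻¹ * (b i)⁻¹ else 1)
          (Fin.natAdd g₀ j)).prod = 1 :=
      List.prod_eq_one fun y hy => by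
        obtain ⟨j, -, rfl⟩ := List.mem_map.mp hy
        simp
    rw [h2, mul_one]
    congr 1
    refine List.map_congr_left fun i _ => ?_
    simp
  have hY' : Y = ((List.finRange g₁).map fun j : Fin g₁ =>
      a (r := r) (Fin.natAdd g₀ j) * b (Fin.natAdd g₀ j) * (a (Fin.natAdd g₀ j))⁻¹ *
        (b (Fin.natAdd g₀ j))⁻¹).prod := by
    rw [hY, prod_map_finRange_add]
    have h1 : ((List.finRange g₀).map fun i : Fin g₀ =>
        (fun i : Fin (g₀ + g₁) => if g₀ ≤ (i : ℕ) then a (r := r) i * b i * (a i)⁻¹ * (b i)⁻¹ else 1)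
          (Fin.castAdd g₁ i)).prod = 1 :=
      List.prod_eq_one fun y hy => by
        obtain ⟨i, -, rfl⟩ := List.mem_map.mp hy
        simp
    rw [h1, one_mul]
    congr 1
    refine List.map_congr_left fun j _ => ?_
    simp
  -- (1) `Φ : Γ → T`
  let fA : Fin (g₀ + g₁) → Bool → Coprod (PuncturedSurfaceGroup g₀ 0) (PuncturedSurfaceGroup g₁ 0) :=
    Fin.addCases (motive := fun _ => Bool → Coprod (PuncturedSurfaceGroup g₀ 0) (PuncturedSurfaceGroup g₁ 0))
      (fun i bit => Coprod.inl (PresentedGroup.of (Sum.inl (i, bit))))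
      (fun j bit => Coprod.inr (PresentedGroup.of (Sum.inl (j, bit))))
  have hfA_left : ∀ i bit, fA (Fin.castAdd g₁ i) bit =
      Coprod.inl (PresentedGroup.of (Sum.inl (i, bit))) := fun i bit => by
    simp only [fA, Fin.addCases_left]
  have hfA_right : ∀ j bit, fA (Fin.natAdd g₀ j) bit =
      Coprod.inr (PresentedGroup.of (Sum.inl (j, bit))) := fun j bit => by
    simp only [fA, Fin.addCases_right]
  let f : puncturedSurfaceGen (g₀ + g₁) r → Coprod (PuncturedSurfaceGroup g₀ 0) (PuncturedSurfaceGroup g₁ 0) :=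
    Sum.elim (fun q => fA q.1 q.2) fun _ => 1
  have hcommA : ∀ i : Fin g₀, f (Sum.inl (Fin.castAdd g₁ i, false)) * f (Sum.inl (Fin.castAdd g₁ i, true)) *
      (f (Sum.inl (Fin.castAdd g₁ i, false)))⁻¹ * (f (Sum.inl (Fin.castAdd g₁ i, true)))⁻¹ =
      Coprod.inl (a (r := 0) i * b i * (a i)⁻¹ * (b i)⁻¹) := fun i => by
    simp only [f, Sum.elim_inl, hfA_left, map_mul, map_inv]; rfl
  have hcommB : ∀ j : Fin g₁, f (Sum.inl (Fin.natAdd g₀ j, false)) * f (Sum.inl (Fin.natAdd g₀ j, true)) *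
      (f (Sum.inl (Fin.natAdd g₀ j, false)))⁻¹ * (f (Sum.inl (Fin.natAdd g₀ j, true)))⁻¹ =
      Coprod.inr (a (r := 0) j * b j * (a j)⁻¹ * (b j)⁻¹) := fun j => by
    simp only [f, Sum.elim_inl, hfA_right, map_mul, map_inv]; rfl
  have hfrel : ∀ v ∈ ({relator (g₀ + g₁) r} : Set (FreeGroup (puncturedSurfaceGen (g₀ + g₁) r))),
      FreeGroup.lift f v = 1 := by
    intro v hv
    rw [Set.mem_singleton_iff] at hv
    rw [hv, lift_relator, prod_map_finRange_add]
    have h3 : ((List.finRange r).map fun j => f (Sum.inr j)).prod = 1 :=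
      List.prod_eq_one fun y hy => by
        obtain ⟨j, -, rfl⟩ := List.mem_map.mp hy
        rfl
    have h1 : ((List.finRange g₀).map fun i : Fin g₀ =>
        f (Sum.inl (Fin.castAdd g₁ i, false)) * f (Sum.inl (Fin.castAdd g₁ i, true)) *
          (f (Sum.inl (Fin.castAdd g₁ i, false)))⁻¹ * (f (Sum.inl (Fin.castAdd g₁ i, true)))⁻¹).prod = 1 := by
      rw [show (fun i : Fin g₀ => f (Sum.inl (Fin.castAdd g₁ i, false)) * f (Sum.inl (Fin.castAdd g₁ i, true)) *
          (f (Sum.inl (Fin.castAdd g₁ i, false)))⁻¹ * (f (Sum.inl (Fin.castAdd g₁ i, true)))⁻¹) =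
          (Coprod.inl : PuncturedSurfaceGroup g₀ 0 →* Coprod (PuncturedSurfaceGroup g₀ 0) (PuncturedSurfaceGroup g₁ 0)) ∘ fun i => a (r := 0) i * b i * (a i)⁻¹ * (b i)⁻¹
          from funext fun i => hcommA i, ← List.map_map, ← map_list_prod, comm_prod_eq_one_zero, map_one]
    have h2 : ((List.finRange g₁).map fun j : Fin g₁ =>
        f (Sum.inl (Fin.natAdd g₀ j, false)) * f (Sum.inl (Fin.natAdd g₀ j, true)) *
          (f (Sum.inl (Fin.natAdd g₀ j, false)))⁻¹ * (f (Sum.inl (Fin.natAdd g₀ j, true)))⁻¹).prod = 1 := by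
      rw [show (fun j : Fin g₁ => f (Sum.inl (Fin.natAdd g₀ j, false)) * f (Sum.inl (Fin.natAdd g₀ j, true)) *
          (f (Sum.inl (Fin.natAdd g₀ j, false)))⁻¹ * (f (Sum.inl (Fin.natAdd g₀ j, true)))⁻¹) =
          (Coprod.inr : PuncturedSurfaceGroup g₁ 0 →* Coprod (PuncturedSurfaceGroup g₀ 0) (PuncturedSurfaceGroup g₁ 0)) ∘ fun j => a (r := 0) j * b j * (a j)⁻¹ * (b j)⁻¹
          from funext fun j => hcommB j, ← List.map_map, ← map_list_prod, comm_prod_eq_one_zero, map_one]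
    rw [h1, h2, h3, one_mul, one_mul]
  let Φ : PuncturedSurfaceGroup (g₀ + g₁) r →* Coprod (PuncturedSurfaceGroup g₀ 0) (PuncturedSurfaceGroup g₁ 0) :=
    PresentedGroup.toGroup hfrel
  have hΦof : ∀ x, Φ (PresentedGroup.of x) = f x := fun x => PresentedGroup.toGroup.of hfrel
  have hΦa : ∀ (i : Fin (g₀ + g₁)) (bit : Bool), Φ (PresentedGroup.of (Sum.inl (i, bit))) = fA i bit :=
    fun i bit => hΦof _
  have hΦc : ∀ j, Φ (c j) = 1 := fun j => hΦof (Sum.inr j)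
  -- `Φ` kills `K`
  have hΦX : Φ X = 1 := by
    rw [hX', map_list_prod, List.map_map]
    have : (Φ ∘ fun i : Fin g₀ => a (r := r) (Fin.castAdd g₁ i) * b (Fin.castAdd g₁ i) *
        (a (Fin.castAdd g₁ i))⁻¹ * (b (Fin.castAdd g₁ i))⁻¹) =
        (Coprod.inl : PuncturedSurfaceGroup g₀ 0 →* Coprod (PuncturedSurfaceGroup g₀ 0) (PuncturedSurfaceGroup g₁ 0)) ∘ fun i => a (r := 0) i * b i * (a i)⁻¹ * (b i)⁻¹ := by
      funext i
      simp only [Function.comp_apply, map_mul, map_inv]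
      rw [a, b, hΦa, hΦa, hfA_left, hfA_left]; rfl
    rw [this, ← List.map_map, ← map_list_prod, comm_prod_eq_one_zero, map_one]
  have hKΦ : K ≤ Φ.ker := by
    refine Subgroup.normalClosure_le_normal ?_
    rintro x (hx | ⟨j, rfl⟩)
    · rw [Set.mem_singleton_iff] at hx
      rw [SetLike.mem_coe, MonoidHom.mem_ker, hx, hε, map_mul, hΦX, mul_one, map_list_prod,
        List.map_map]
      exact List.prod_eq_one fun y hy => by
        obtain ⟨j, -, rfl⟩ := List.mem_map.mp hy
        simp only [Function.comp_apply]
        split_ifs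
        · exact hΦc j
        · exact map_one Φ
    · rw [SetLike.mem_coe, MonoidHom.mem_ker]; exact hΦc j
  let Φb : PuncturedSurfaceGroup (g₀ + g₁) r ⧸ K →* Coprod (PuncturedSurfaceGroup g₀ 0) (PuncturedSurfaceGroup g₁ 0) :=
    QuotientGroup.lift K Φ hKΦ
  have hΦb : ∀ x : PuncturedSurfaceGroup (g₀ + g₁) r, Φb (QuotientGroup.mk x) = Φ x := fun x => QuotientGroup.lift_mk' K hKΦ x
  -- (2) `Ψ : T → Γ/K`
  let f₀ : puncturedSurfaceGen g₀ 0 → PuncturedSurfaceGroup (g₀ + g₁) r ⧸ K :=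
    Sum.elim (fun q => QuotientGroup.mk (PresentedGroup.of (Sum.inl (Fin.castAdd g₁ q.1, q.2)))) Fin.elim0
  have hf₀rel : ∀ v ∈ ({relator g₀ 0} : Set (FreeGroup (puncturedSurfaceGen g₀ 0))),
      FreeGroup.lift f₀ v = 1 := by
    intro v hv
    rw [Set.mem_singleton_iff] at hv
    rw [hv, lift_relator, List.finRange_zero, List.map_nil, List.prod_nil, mul_one]
    have : (fun i : Fin g₀ => f₀ (Sum.inl (i, false)) * f₀ (Sum.inl (i, true)) * (f₀ (Sum.inl (i, false)))⁻¹ *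
        (f₀ (Sum.inl (i, true)))⁻¹) = (QuotientGroup.mk' K) ∘ fun i => a (r := r) (Fin.castAdd g₁ i) *
          b (Fin.castAdd g₁ i) * (a (Fin.castAdd g₁ i))⁻¹ * (b (Fin.castAdd g₁ i))⁻¹ := by
      funext i; simp only [f₀, Sum.elim_inl, Function.comp_apply, map_mul, map_inv]; rfl
    rw [this, ← List.map_map, ← map_list_prod, ← hX', QuotientGroup.mk'_apply, QuotientGroup.eq_one_iff]
    exact hXK
  let ψ₀ : PuncturedSurfaceGroup g₀ 0 →* PuncturedSurfaceGroup (g₀ + g₁) r ⧸ K := PresentedGroup.toGroup hf₀rel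
  have hψ₀ : ∀ (i : Fin g₀) (bit : Bool), ψ₀ (PresentedGroup.of (Sum.inl (i, bit))) =
      QuotientGroup.mk (PresentedGroup.of (Sum.inl (Fin.castAdd g₁ i, bit))) :=
    fun i bit => PresentedGroup.toGroup.of hf₀rel
  let f₁ : puncturedSurfaceGen g₁ 0 → PuncturedSurfaceGroup (g₀ + g₁) r ⧸ K :=
    Sum.elim (fun q => QuotientGroup.mk (PresentedGroup.of (Sum.inl (Fin.natAdd g₀ q.1, q.2)))) Fin.elim0
  have hf₁rel : ∀ v ∈ ({relator g₁ 0} : Set (FreeGroup (puncturedSurfaceGen g₁ 0))),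
      FreeGroup.lift f₁ v = 1 := by
    intro v hv
    rw [Set.mem_singleton_iff] at hv
    rw [hv, lift_relator, List.finRange_zero, List.map_nil, List.prod_nil, mul_one]
    have : (fun j : Fin g₁ => f₁ (Sum.inl (j, false)) * f₁ (Sum.inl (j, true)) * (f₁ (Sum.inl (j, false)))⁻¹ *
        (f₁ (Sum.inl (j, true)))⁻¹) = (QuotientGroup.mk' K) ∘ fun j => a (r := r) (Fin.natAdd g₀ j) *
          b (Fin.natAdd g₀ j) * (a (Fin.natAdd g₀ j))⁻¹ * (b (Fin.natAdd g₀ j))⁻¹ := by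
      funext j; simp only [f₁, Sum.elim_inl, Function.comp_apply, map_mul, map_inv]; rfl
    rw [this, ← List.map_map, ← map_list_prod, ← hY', QuotientGroup.mk'_apply, QuotientGroup.eq_one_iff]
    exact hYK
  let ψ₁ : PuncturedSurfaceGroup g₁ 0 →* PuncturedSurfaceGroup (g₀ + g₁) r ⧸ K := PresentedGroup.toGroup hf₁rel
  have hψ₁ : ∀ (j : Fin g₁) (bit : Bool), ψ₁ (PresentedGroup.of (Sum.inl (j, bit))) =
      QuotientGroup.mk (PresentedGroup.of (Sum.inl (Fin.natAdd g₀ j, bit))) :=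
    fun j bit => PresentedGroup.toGroup.of hf₁rel
  let Ψ : Coprod (PuncturedSurfaceGroup g₀ 0) (PuncturedSurfaceGroup g₁ 0) →* PuncturedSurfaceGroup (g₀ + g₁) r ⧸ K :=
    Coprod.lift ψ₀ ψ₁
  -- (3) the two compositions
  have h1 : Ψ.comp Φb = MonoidHom.id _ := by
    refine QuotientGroup.monoidHom_ext _ (PresentedGroup.ext fun x => ?_)
    change Ψ (Φb (QuotientGroup.mk (PresentedGroup.of x))) = QuotientGroup.mk (PresentedGroup.of x)
    rw [hΦb, hΦof]
    rcases x with ⟨i, bit⟩ | j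
    · change Ψ (fA i bit) = _
      induction i using Fin.addCases with
      | left i₀ =>
        rw [hfA_left]
        show Coprod.lift ψ₀ ψ₁ (Coprod.inl _) = _
        rw [Coprod.lift_apply_inl, hψ₀]
      | right j₀ =>
        rw [hfA_right]
        show Coprod.lift ψ₀ ψ₁ (Coprod.inr _) = _
        rw [Coprod.lift_apply_inr, hψ₁]
    · change Ψ 1 = QuotientGroup.mk (c j)
      rw [map_one, eq_comm, QuotientGroup.eq_one_iff]
      exact hcK j
  have h2 : Φb.comp Ψ = MonoidHom.id _ := by
    refine Coprod.hom_ext (PresentedGroup.ext fun y => ?_) (PresentedGroup.ext fun y => ?_)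
    · change Φb (Ψ (Coprod.inl (PresentedGroup.of y))) = Coprod.inl (PresentedGroup.of y)
      rcases y with ⟨i, bit⟩ | j
      · show Φb (Coprod.lift ψ₀ ψ₁ (Coprod.inl (PresentedGroup.of _))) = _
        rw [Coprod.lift_apply_inl, hψ₀, hΦb, hΦa, hfA_left]
      · exact Fin.elim0 j
    · change Φb (Ψ (Coprod.inr (PresentedGroup.of y))) = Coprod.inr (PresentedGroup.of y)
      rcases y with ⟨j, bit⟩ | j
      · show Φb (Coprod.lift ψ₀ ψ₁ (Coprod.inr (PresentedGroup.of _))) = _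
        rw [Coprod.lift_apply_inr, hψ₁, hΦb, hΦa, hfA_right]
      · exact Fin.elim0 j
  refine ⟨hKn, MonoidHom.toMulEquiv Φb Ψ h1 h2, fun i bit => ?_, fun j bit => ?_⟩
  · rw [MonoidHom.toMulEquiv_apply, hΦb, hΦa, hfA_left]
  · rw [MonoidHom.toMulEquiv_apply, hΦb, hΦa, hfA_right]

end PuncturedSurfaceGroup

end Literature.GroupTheory.CombinatorialGroupTheory
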